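import Summits.CriticalPhenomena.Ising3DConformalLimit.Theorems.HarmonicMomentsIsotropyDilutionTransferNuB2
import Summits.CriticalPhenomena.Ising3DConformalLimit.Theorems.HarmonicMomentsIsotropyDilutionTransferInvariance
import Summits.CriticalPhenomena.Ising3DConformalLimit.Theorems.HarmonicMomentsIsotropyDilutionTransferTransfer
import Summits.CriticalPhenomena.Ising3DConformalLimit.Theses.HarmonicMomentsIsotropy

/-!
# Item `DilutionTransfer` (stmt-CriticalPhenomena-6037): the proof

Support file for item `DilutionTransfer` (stmt-CriticalPhenomena-6037) of route
`HarmonicMomentsIsotropy` (sub-problem `Ising3DConformalLimit`).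

* `ratio_estimate`, `window_condition`, `integral_ge_of_cube`,
  `exists_linearIsometryEquiv_of_orthogonal` — last pieces of bookkeeping;
* `dilutionTransfer_core` — the transfer with normalised hypotheses;
* `dilutionTransfer_proof : …Theses.HarmonicMomentsIsotropy.DilutionTransfer` — **the item**:
  `HarmonicDilution → CorrelationLengthWindow → ExistsScaleCovariantLimit → TwoPointAsymptoticIsotropy`.

Proof architecture (files `HarmonicMomentsIsotropyDilutionTransfer*`): `Laplacian`, `Fischer` (harmonic
decomposition of `(ξ·y)ᵏ`), `Determinacy` (moments + exponential moment determine the law;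
rotation invariance from radial marginal moments), `WeakLimit` (Prokhorov, moment convergence),
`Defs` (`ν_β`, `χ`, `M₂`, `ξ₂`), `Ising` (tree inputs), `LatticeSumsA/B` (lattice sums as integrals,
Riemann sums from the pointwise scaling limit), `DoublingA/B` (shell growth, Karamata, doubling),
`NuA/NuB1/NuB2` (`ν_β`: lattice formulas, exponential moments, `ξ₂ → ∞`, charging), `Invariance`
(asymptotic `O(3)`-invariance), `Transfer` (window transfer, scale matching), and this file.
-/

noncomputable section

open MeasureTheory Filter Topology Set MvPolynomial
open scoped ENNReal NNReal BigOperators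
open Literature.Probability.LatticeModels

namespace Summit.CriticalPhenomena.Ising3DConformalLimit.Theorems.HarmonicMomentsIsotropy

open scoped Classical

/-! ## An orthogonal matrix as a linear isometry of Euclidean `ℝ³` -/

/-- The linear isometry of Euclidean `ℝ³` given by an orthogonal matrix. -/
theorem exists_linearIsometryEquiv_of_orthogonal (R : Matrix.orthogonalGroup (Fin 3) ℝ) :
    ∃ T : V ≃ₗᵢ[ℝ] V, ∀ y : V, WithLp.ofLp (T y) = R.1.mulVec (WithLp.ofLp y) := by
  have hR1 : Matrix.transpose R.1 * R.1 = 1 := (Matrix.mem_orthogonalGroup_iff' (Fin 3) ℝ).1 R.2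
  have hR2 : R.1 * Matrix.transpose R.1 = 1 := (Matrix.mem_orthogonalGroup_iff (Fin 3) ℝ).1 R.2
  -- the linear equivalence on `Fin 3 → ℝ`
  set f : (Fin 3 → ℝ) →ₗ[ℝ] (Fin 3 → ℝ) := Matrix.toLin' R.1 with hf
  set g : (Fin 3 → ℝ) →ₗ[ℝ] (Fin 3 → ℝ) := Matrix.toLin' (Matrix.transpose R.1) with hg
  have hfg : f.comp g = LinearMap.id := by
    rw [hf, hg, ← Matrix.toLin'_mul, hR2, Matrix.toLin'_one]
  have hgf : g.comp f = LinearMap.id := by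
    rw [hf, hg, ← Matrix.toLin'_mul, hR1, Matrix.toLin'_one]
  set e : (Fin 3 → ℝ) ≃ₗ[ℝ] (Fin 3 → ℝ) := LinearEquiv.ofLinear f g hfg hgf with he
  -- conjugate by `WithLp`
  set eV : V ≃ₗ[ℝ] V := (WithLp.linearEquiv 2 ℝ (Fin 3 → ℝ)).trans
    (e.trans (WithLp.linearEquiv 2 ℝ (Fin 3 → ℝ)).symm) with heV
  have heV_apply : ∀ y : V, WithLp.ofLp (eV y) = R.1.mulVec (WithLp.ofLp y) := by
    intro y
    simp [heV, he, hf, Matrix.toLin'_apply]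
  have hinner : ∀ x y : V, inner ℝ (eV x) (eV y) = inner ℝ x y := by
    intro x y
    have h1 : ∀ u w : V, inner ℝ u w = ∑ i, (WithLp.ofLp u) i * (WithLp.ofLp w) i := by
      intro u w
      simp [PiLp.inner_apply, mul_comm]
    rw [h1, h1, heV_apply, heV_apply]
    have : ∀ u w : Fin 3 → ℝ, (∑ i, R.1.mulVec u i * R.1.mulVec w i) = ∑ i, u i * w i := by
      intro u w
      have key : dotProduct (R.1.mulVec u) (R.1.mulVec w) = dotProduct u w := by
        rw [Matrix.dotProduct_mulVec, ← Matrix.vecMul_transpose, Matrix.vecMul_vecMul, hR1,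
          Matrix.vecMul_one]
      simpa [dotProduct] using key
    exact this _ _
  exact ⟨eV.isometryOfInner hinner, fun y => by
    rw [LinearEquiv.coe_isometryOfInner]; exact heV_apply y⟩

/-! ## The item -/

/-! ## Arithmetic of the final comparison -/

/-- The final ratio estimate: if `(1-ε)D ≤ χ I ≤ D`, `(1-ε)N ≤ χ I_R ≤ N`, `|I_R - I| ≤ ε I`,
`I > 0`, `χ > 0`, `N ≥ 0` and `0 < ε ≤ 1/2`, then `|N/D - 1| ≤ 4ε`. -/
theorem ratio_estimate {D N I IR χ ε : ℝ} (hε0 : 0 < ε) (hε2 : ε ≤ 1 / 2) (hχ : 0 < χ)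
    (hI : 0 < I) (_hN : 0 ≤ N) (hD1 : (1 - ε) * D ≤ χ * I) (hD2 : χ * I ≤ D)
    (hN1 : (1 - ε) * N ≤ χ * IR) (hN2 : χ * IR ≤ N) (hIR : |IR - I| ≤ ε * I) :
    |N / D - 1| ≤ 4 * ε := by
  have hε1 : 0 < 1 - ε := by linarith
  have hDpos : 0 < D := lt_of_lt_of_le (mul_pos hχ hI) hD2
  have hIRu : IR ≤ (1 + ε) * I := by have := (abs_le.1 hIR).2; linarith
  have hIRl : (1 - ε) * I ≤ IR := by have := (abs_le.1 hIR).1; linarith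
  have hIR0 : 0 ≤ IR := le_trans (by positivity) hIRl
  -- upper bound: `N (1-ε) I χ ≤ χ IR · I χ`... we work with `N ≤ χ IR/(1-ε)` and `D ≥ χ I`
  have hup : N / D ≤ (1 + ε) / (1 - ε) := by
    rw [div_le_div_iff₀ hDpos hε1]
    have h1 : N * (1 - ε) ≤ χ * IR := by linarith
    have h2 : χ * IR ≤ χ * ((1 + ε) * I) := mul_le_mul_of_nonneg_left hIRu hχ.le
    have h3 : χ * I ≤ D := hD2
    nlinarith
  have hlow : (1 - ε) * (1 - ε) ≤ N / D := by
    rw [le_div_iff₀ hDpos]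
    have h1 : (1 - ε) * D ≤ χ * I := hD1
    have h2 : χ * ((1 - ε) * I) ≤ χ * IR := mul_le_mul_of_nonneg_left hIRl hχ.le
    have h3 : χ * IR ≤ N := hN2
    nlinarith
  rw [abs_le]
  constructor
  · nlinarith
  · have h1 : (1 + ε) / (1 - ε) ≤ 1 + 4 * ε := by
      rw [div_le_iff₀ hε1]; nlinarith
    linarith

/-- `‖v‖_∞² ≤ 3 ‖Rv‖_∞²` for `R ∈ O(3)` (through `∑ vᵢ² = ∑ (Rv)ᵢ²`). -/
theorem norm_sq_le_three_mul_norm_mulVec_sq (R : Matrix.orthogonalGroup (Fin 3) ℝ)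
    (v : Fin 3 → ℝ) : ‖v‖ ^ 2 ≤ 3 * ‖R.1.mulVec v‖ ^ 2 := by
  have h1 := sum_sq_le_three_mul_norm_sq (R.1.mulVec v)
  rw [sum_sq_mulVec_eq] at h1
  refine le_trans ?_ h1
  have hv : ‖v‖ ≤ Real.sqrt (∑ j, (v j) ^ 2) := by
    refine (pi_norm_le_iff_of_nonneg (Real.sqrt_nonneg _)).2 fun j => ?_
    rw [Real.norm_eq_abs, ← Real.sqrt_sq_eq_abs]
    exact Real.sqrt_le_sqrt (Finset.single_le_sum (f := fun j => (v j) ^ 2)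
      (fun j _ => sq_nonneg _) (Finset.mem_univ j))
  calc ‖v‖ ^ 2 ≤ (Real.sqrt (∑ j, (v j) ^ 2)) ^ 2 := pow_le_pow_left₀ (norm_nonneg _) hv 2
    _ = ∑ j, (v j) ^ 2 := Real.sq_sqrt (Finset.sum_nonneg fun j _ => sq_nonneg _)

/-- The window condition: if `φ(κ v) ≠ 0` forces `‖v‖_∞ < Bφ/κ` and `κ² s ≥ 36 Bφ²`, then every
lattice point `x` with `v ∈ {x/ξ₂, Rx/ξ₂}` satisfies `|x|² χ ≤ s M₂`. -/
theorem window_condition {β : ℝ} (hβ : 0 ≤ β) (hβc : β < criticalBeta 3) (hξ : 0 < xi β)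
    {κ Bφ s : ℝ} (hκ : 0 < κ) (hκs : 36 * Bφ ^ 2 ≤ κ ^ 2 * s) (R : Matrix.orthogonalGroup (Fin 3) ℝ)
    {v : Fin 3 → ℝ} (hvB : ‖v‖ * κ < Bφ) (x : Site 3)
    (hvx : v = (xi β)⁻¹ • siteW x ∨ v = (xi β)⁻¹ • R.1.mulVec (siteW x)) :
    (∑ i, ((x i : ℤ) : ℝ) ^ 2) * chi β ≤ s * msq β := by
  have hsumsq : (∑ i, ((x i : ℤ) : ℝ) ^ 2) = xi β ^ 2 * ∑ i, (v i) ^ 2 := by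
    have hsW : ∀ i, siteW x i = ((x i : ℤ) : ℝ) := fun i => rfl
    have hsq : ∀ u : Fin 3 → ℝ, (∑ i, (((xi β)⁻¹ • u) i) ^ 2) = (xi β)⁻¹ ^ 2 * ∑ i, (u i) ^ 2 := by
      intro u; simp only [Pi.smul_apply, smul_eq_mul, mul_pow, Finset.mul_sum]
    rcases hvx with rfl | rfl
    · rw [hsq, ← mul_assoc, ← mul_pow, mul_inv_cancel₀ hξ.ne', one_pow, one_mul]
      simp only [hsW]
    · rw [hsq, sum_sq_mulVec_eq, ← mul_assoc, ← mul_pow, mul_inv_cancel₀ hξ.ne', one_pow, one_mul]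
      simp only [hsW]
  have h3 := sum_sq_le_three_mul_norm_sq v
  have hv2 : ‖v‖ ^ 2 * κ ^ 2 ≤ Bφ ^ 2 := by
    rw [← mul_pow]
    exact pow_le_pow_left₀ (by positivity) hvB.le 2
  have hkey : (∑ i, (v i) ^ 2) * κ ^ 2 ≤ s * κ ^ 2 := by nlinarith
  have hkey' : (∑ i, (v i) ^ 2) ≤ s := le_of_mul_le_mul_right hkey (by positivity)
  have hξ2 : xi β ^ 2 * chi β = msq β := by rw [xi_sq hβ hβc]; field_simp [(chi_pos hβ hβc).ne']
  calc (∑ i, ((x i : ℤ) : ℝ) ^ 2) * chi β = (∑ i, (v i) ^ 2) * (xi β ^ 2 * chi β) := by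
        rw [hsumsq]; ring
    _ ≤ s * (xi β ^ 2 * chi β) := mul_le_mul_of_nonneg_right hkey' (by
        rw [hξ2]; exact msq_nonneg hβ)
    _ = s * msq β := by rw [hξ2]

/-- Lower bound of `∫ φ(κ y) dν_β` by the `ν_β`-mass of the cube where `φ(κ ·) ≥ m₁`. -/
theorem integral_ge_of_cube {β : ℝ} (hβ : 0 ≤ β) (hβc : β < criticalBeta 3)
    {φ : (Fin 3 → ℝ) → ℝ} (hφc : Continuous φ) (hφ0 : ∀ v, 0 ≤ φ v) {Φ : ℝ} (hφb : ∀ v, |φ v| ≤ Φ)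
    {κ : ℝ} (hκ : 0 < κ) {v₁ : Fin 3 → ℝ} {r₁ m₁ : ℝ}
    (hcube : ∀ v ∈ Metric.closedBall v₁ r₁, m₁ ≤ φ v) :
    ((nu β) {y | WithLp.ofLp y ∈ Metric.closedBall (κ⁻¹ • v₁) (κ⁻¹ * r₁)}).toReal * m₁ ≤
      ∫ y, φ (κ • WithLp.ofLp y) ∂(nu β) := by
  haveI := isProbabilityMeasure_nu hβ hβc
  set Q : Set V := {y | WithLp.ofLp y ∈ Metric.closedBall (κ⁻¹ • v₁) (κ⁻¹ * r₁)} with hQ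
  have hQm : MeasurableSet Q :=
    measurableSet_closedBall.preimage (PiLp.continuous_ofLp 2 _).measurable
  have hψc : Continuous fun y : V => φ (κ • WithLp.ofLp y) :=
    hφc.comp ((PiLp.continuous_ofLp 2 _).const_smul κ)
  have hψint : Integrable (fun y : V => φ (κ • WithLp.ofLp y)) (nu β) := by
    refine (integrable_const Φ).mono' hψc.aestronglyMeasurable (ae_of_all _ fun y => ?_)
    rw [Real.norm_eq_abs]; exact hφb _
  have hle : ∀ y, Q.indicator (fun _ => m₁) y ≤ φ (κ • WithLp.ofLp y) := by
    intro y
    by_cases hy : y ∈ Q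
    · rw [indicator_of_mem hy]
      refine hcube _ ?_
      rw [hQ, mem_setOf_eq, Metric.mem_closedBall, dist_eq_norm] at hy
      rw [Metric.mem_closedBall, dist_eq_norm]
      have : κ • WithLp.ofLp y - v₁ = κ • (WithLp.ofLp y - κ⁻¹ • v₁) := by
        rw [smul_sub, smul_smul, mul_inv_cancel₀ hκ.ne', one_smul]
      rw [this, norm_smul, Real.norm_eq_abs, abs_of_pos hκ]
      calc κ * ‖WithLp.ofLp y - κ⁻¹ • v₁‖ ≤ κ * (κ⁻¹ * r₁) := mul_le_mul_of_nonneg_left hy hκ.le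
        _ = r₁ := by field_simp
    · rw [indicator_of_notMem hy]; exact hφ0 _
  calc ((nu β) Q).toReal * m₁ = ∫ y, Q.indicator (fun _ => m₁) y ∂(nu β) := by
        rw [integral_indicator hQm, setIntegral_const, smul_eq_mul, Measure.real]
    _ ≤ ∫ y, φ (κ • WithLp.ofLp y) ∂(nu β) :=
        integral_mono ((integrable_const m₁).indicator hQm) hψint hle

/-- **Core of the transfer** with normalised hypotheses: harmonic dilution (`hHD`), the critical
window CLW (i) (`hI`), the one-length window CLW (ii) (`hii`) and a scale-covariant non-degenerate
pointwise limit (`hρ`, `hlim`, `hnd`, `hsc`) give vague asymptotic isotropy of the critical two-point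
function. -/
theorem dilutionTransfer_core
    (hHD : ∀ (n m : ℕ) (Y : MvPolynomial (Fin 3) ℝ), 1 ≤ n → Y.IsHomogeneous n →
      (∑ i : Fin 3, pderiv i (pderiv i Y)) = 0 →
      Tendsto (fun β => (∑' x : Site 3, eval (fun i => ((x i : ℤ) : ℝ)) Y *
          Real.sqrt (∑ i, ((x i : ℤ) : ℝ) ^ 2) ^ (2 * m) * twoPointFree 3 β x) /
        (∑' x : Site 3, Real.sqrt (∑ i, ((x i : ℤ) : ℝ) ^ 2) ^ (n + 2 * m) * twoPointFree 3 β x))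
        (𝓝[<] (criticalBeta 3)) (𝓝 0))
    (hI : ∀ ε : ℝ, 0 < ε → ∃ s : ℝ, 0 < s ∧ ∃ β₀ : ℝ, β₀ < criticalBeta 3 ∧ ∀ β : ℝ, β₀ ≤ β →
      β < criticalBeta 3 → ∀ x : Site 3, (∑ i, ((x i : ℤ) : ℝ) ^ 2) * chi β ≤ s * msq β →
        (1 - ε) * criticalTwoPoint 3 x ≤ twoPointFree 3 β x)
    {c₀ C β₀ : ℝ} (hc₀ : 0 < c₀) (hβ₀ : β₀ < criticalBeta 3)
    (hii : ∀ β : ℝ, β₀ ≤ β → β < criticalBeta 3 → ∀ A : ℝ, 1 ≤ A →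
      (∑' x : Site 3, if A ^ 2 * msq β < (∑ i, ((x i : ℤ) : ℝ) ^ 2) * chi β
        then twoPointFree 3 β x else 0) ≤ C * Real.exp (-(c₀ * A)) * chi β)
    {ρ : ℝ → ℝ} {Δ : ℝ} {S : CorrFamily 3} (hρ : ∀ δ ∈ Set.Ioc (0 : ℝ) 1, 0 < ρ δ)
    (hlim : HasPointwiseScalingLimit (criticalCorr 3) ρ S) (hnd : IsNondegenerateTwoPoint S)
    (hsc : IsScaleCovariant Δ S)
    (φ : (Fin 3 → ℝ) → ℝ) (hφc : Continuous φ) (hφs : HasCompactSupport φ) (hφ0 : ∀ v, 0 ≤ φ v)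
    (hφpos : ∃ v, 0 < φ v) (R : Matrix.orthogonalGroup (Fin 3) ℝ) :
    Tendsto (fun L : ℝ => (∑' x : Site 3, φ (L⁻¹ • (R.1.mulVec (fun i => ((x i : ℤ) : ℝ)))) *
        criticalTwoPoint 3 x) / (∑' x : Site 3, φ (L⁻¹ • (fun i => ((x i : ℤ) : ℝ))) *
        criticalTwoPoint 3 x)) atTop (𝓝 1) := by
  -- data from `φ`
  obtain ⟨Bφ, hBφ, hsupp⟩ := exists_support_bound hφs
  obtain ⟨Φ, hΦ⟩ := hφc.bounded_above_of_compact_support hφs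
  have hφb : ∀ v, |φ v| ≤ Φ := fun v => by have := hΦ v; rwa [Real.norm_eq_abs] at this
  obtain ⟨v₁, r₁, m₁, hv₁0, hr₁, hr₁v, hm₁, hcube⟩ := exists_pos_cube hφc hφpos
  have hv₁B : ‖v₁‖ < Bφ := hsupp v₁ (hm₁.trans_le (hcube v₁ (Metric.mem_closedBall_self hr₁.le))).ne'
  obtain ⟨T, hT⟩ := exists_linearIsometryEquiv_of_orthogonal R
  -- CLW data: the `ε = 1/2` window for charging; `ξ₂ → ∞`
  obtain ⟨s₁, hs₁, β₁, hβ₁, hI1⟩ := hI (1 / 2) (by norm_num)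
  have hξtop := tendsto_xi_atTop hc₀ hβ₀ hii
  -- the `ε`-argument
  rw [Metric.tendsto_atTop]
  intro ε' hε'
  set ε : ℝ := min (ε' / 5) (1 / 2) with hε
  have hε0 : 0 < ε := by positivity
  have hε2 : ε ≤ 1 / 2 := min_le_right _ _
  have hε5 : 5 * ε ≤ ε' := by have := min_le_left (ε' / 5) (1 / 2); linarith
  obtain ⟨s, hs, β₂, hβ₂, hI2⟩ := hI ε hε0
  -- the scale `κ`
  set sm : ℝ := min s s₁ with hsm_def
  have hsm : 0 < sm := lt_min hs hs₁
  set κ : ℝ := 6 * Bφ / Real.sqrt sm with hκ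
  have hκ0 : 0 < κ := by positivity
  have hκsq : κ ^ 2 * sm = 36 * Bφ ^ 2 := by
    rw [hκ, div_pow, Real.sq_sqrt hsm.le]; field_simp; ring
  -- (CH) charging of the cube where `φ(κ ·) ≥ m₁`
  set w : Fin 3 → ℝ := κ⁻¹ • v₁ with hw
  have hnw : ‖w‖ = κ⁻¹ * ‖v₁‖ := by rw [hw, norm_smul, Real.norm_eq_abs, abs_of_pos (inv_pos.2 hκ0)]
  have hv₁pos : 0 < ‖v₁‖ := norm_pos_iff.2 hv₁0
  obtain ⟨ι, hι, hcharge⟩ := nu_charge hρ hlim hsc hnd hβ₁ (s₁ := s₁)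
    (fun β h1 h2 x hx => by have := hI1 β h1 h2 x hx; linarith) hc₀ hβ₀ hii w
    (r := κ⁻¹ * r₁) (η := κ⁻¹ * (‖v₁‖ / 4)) (by positivity) (by positivity)
    (by rw [hnw]; have : r₁ + ‖v₁‖ / 4 < ‖v₁‖ := by linarith
        calc κ⁻¹ * r₁ + κ⁻¹ * (‖v₁‖ / 4) = κ⁻¹ * (r₁ + ‖v₁‖ / 4) := by ring
          _ < κ⁻¹ * ‖v₁‖ := mul_lt_mul_of_pos_left this (inv_pos.2 hκ0))
    (by
      rw [hnw, ← mul_add, mul_pow, inv_pow]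
      have h1 : (‖v₁‖ + r₁) ^ 2 ≤ (2 * Bφ) ^ 2 := by
        apply pow_le_pow_left₀ (by positivity); linarith
      have h2 : 9 * (2 * Bφ) ^ 2 = κ ^ 2 * sm := by rw [hκsq]; ring
      calc 9 * ((κ ^ 2)⁻¹ * (‖v₁‖ + r₁) ^ 2) ≤ 9 * ((κ ^ 2)⁻¹ * (2 * Bφ) ^ 2) := by gcongr
        _ = (κ ^ 2)⁻¹ * (κ ^ 2 * sm) := by rw [← h2]; ring
        _ = sm := by field_simp
        _ ≤ s₁ := min_le_right _ _)
  -- (AI) asymptotic invariance for `ψ = φ(κ ·)`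
  set ψ : V → ℝ := fun y => φ (κ • WithLp.ofLp y) with hψ
  have hψc : Continuous ψ := hφc.comp ((PiLp.continuous_ofLp 2 _).const_smul κ)
  have hAI := asymptotic_invariance hHD hc₀ hβ₀ hii ψ hψc (fun y => hφb _) T
  -- collect: eventually in `β`, `|I_R - I| ≤ ε ι m₁` and `I ≥ ι m₁`
  have hI_low : ∀ᶠ β in 𝓝[<] (criticalBeta 3), ι * m₁ ≤ ∫ y, ψ y ∂(nu β) ∧ 0 < β := by
    have h0 : ∀ᶠ β in 𝓝[<] (criticalBeta 3), 0 < β ∧ β < criticalBeta 3 := by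
      have : Ioo 0 (criticalBeta 3) ∈ 𝓝[<] (criticalBeta 3) := Ioo_mem_nhdsLT (criticalBeta_pos_holds (d := 3) (by norm_num))
      filter_upwards [this] with β hβ using hβ
    filter_upwards [hcharge, h0] with β hβ h0β
    refine ⟨?_, h0β.1⟩
    have h := integral_ge_of_cube h0β.1.le h0β.2 hφc hφ0 hφb hκ0 hcube (v₁ := v₁) (r₁ := r₁)
    calc ι * m₁ ≤ ((nu β) {y | WithLp.ofLp y ∈ Metric.closedBall (κ⁻¹ • v₁) (κ⁻¹ * r₁)}).toReal * m₁ :=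
          mul_le_mul_of_nonneg_right hβ hm₁.le
      _ ≤ ∫ y, ψ y ∂(nu β) := h
  have hιm : 0 < ι * m₁ := mul_pos hι hm₁
  have hAI' : ∀ᶠ β in 𝓝[<] (criticalBeta 3), |(∫ y, ψ (T y) ∂(nu β)) - ∫ y, ψ y ∂(nu β)| <
      ε * (ι * m₁) := by
    have := (Metric.tendsto_nhds.1 hAI) (ε * (ι * m₁)) (by positivity)
    filter_upwards [this] with β hβ
    rwa [Real.dist_eq, sub_zero] at hβ
  -- a threshold `b < β_c` beyond which everything holds
  obtain ⟨b, hb, hbprop⟩ : ∃ b < criticalBeta 3, ∀ β, b < β → β < criticalBeta 3 →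
      (ι * m₁ ≤ ∫ y, ψ y ∂(nu β) ∧ 0 < β) ∧
      |(∫ y, ψ (T y) ∂(nu β)) - ∫ y, ψ y ∂(nu β)| < ε * (ι * m₁) ∧ max (max β₁ β₂) β₀ < β := by
    have hmax : ∀ᶠ β in 𝓝[<] (criticalBeta 3), max (max β₁ β₂) β₀ < β := by
      have : Ioo (max (max β₁ β₂) β₀) (criticalBeta 3) ∈ 𝓝[<] (criticalBeta 3) :=
        Ioo_mem_nhdsLT (max_lt (max_lt hβ₁ hβ₂) hβ₀)
      filter_upwards [this] with β hβ using hβ.1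
    obtain ⟨b, hb, hsub⟩ := mem_nhdsLT_iff_exists_Ioo_subset.1 ((hI_low.and hAI').and hmax)
    exact ⟨b, hb, fun β h1 h2 => by have := hsub ⟨h1, h2⟩; exact ⟨this.1.1, this.1.2, this.2⟩⟩
  -- choose `β(L)` with `ξ₂(β(L)) = κ L`
  obtain ⟨L₀, hL₀⟩ := exists_beta_matching_scale hξtop hκ0 hb
  refine ⟨max L₀ 1, fun L hL => ?_⟩
  have hL1 : 1 ≤ L := (le_max_right _ _).trans hL
  have hLpos : 0 < L := by linarith
  obtain ⟨β, hbβ, hβc, hξL⟩ := hL₀ L ((le_max_left _ _).trans hL)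
  obtain ⟨⟨hIlow, hβ0⟩, hAIβ, hmaxβ⟩ := hbprop β hbβ hβc
  have hβ₁β : β₁ ≤ β := ((le_max_left _ _).trans (le_max_left _ _)).trans hmaxβ.le
  have hβ₂β : β₂ ≤ β := ((le_max_right _ _).trans (le_max_left _ _)).trans hmaxβ.le
  have hξpos : 0 < xi β := by rw [hξL]; positivity
  have hχ := chi_pos hβ0.le hβc
  -- the two test functions on `ℝ³` at scale `ξ₂(β)`
  set ψ₀ : (Fin 3 → ℝ) → ℝ := fun v => φ (κ • v) with hψ₀
  set ψR : (Fin 3 → ℝ) → ℝ := fun v => φ (κ • R.1.mulVec v) with hψR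
  have hRc : Continuous fun v : Fin 3 → ℝ => R.1.mulVec v :=
    (Matrix.toLin' R.1).continuous_of_finiteDimensional |>.congr fun v => Matrix.toLin'_apply _ _
  have hψ₀m : Measurable ψ₀ := (hφc.comp (continuous_const_smul κ)).measurable
  have hψRm : Measurable ψR := (hφc.comp ((continuous_const_smul κ).comp hRc)).measurable
  -- window condition: support read at scale `ξ₂` lies where `(1-ε)G_c ≤ G_β`
  have hLinv : L⁻¹ = κ * (xi β)⁻¹ := by rw [hξL, mul_inv, ← mul_assoc, mul_inv_cancel₀ hκ0.ne', one_mul]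
  have hκs : 36 * Bφ ^ 2 ≤ κ ^ 2 * s := by
    rw [← hκsq]; exact mul_le_mul_of_nonneg_left (min_le_left _ _) (sq_nonneg _)
  have hwindow : ∀ v : Fin 3 → ℝ, φ (κ • v) ≠ 0 → ∀ x : Site 3, v = (xi β)⁻¹ • siteW x ∨
      v = (xi β)⁻¹ • R.1.mulVec (siteW x) → (∑ i, ((x i : ℤ) : ℝ) ^ 2) * chi β ≤ s * msq β := by
    intro v hv x hvx
    have hvB : ‖κ • v‖ < Bφ := hsupp _ hv
    rw [norm_smul, Real.norm_eq_abs, abs_of_pos hκ0, mul_comm] at hvB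
    exact window_condition hβ0.le hβc hξpos hκ0 hκs R hvB x hvx
  have hwin₀ : ∀ x : Site 3, ψ₀ ((xi β)⁻¹ • siteW x) ≠ 0 →
      (1 - ε) * criticalTwoPoint 3 x ≤ twoPointFree 3 β x := fun x hx =>
    hI2 β hβ₂β hβc x (hwindow _ hx x (Or.inl rfl))
  have hwinR : ∀ x : Site 3, ψR ((xi β)⁻¹ • siteW x) ≠ 0 →
      (1 - ε) * criticalTwoPoint 3 x ≤ twoPointFree 3 β x := fun x hx => by
    refine hI2 β hβ₂β hβc x (hwindow ((xi β)⁻¹ • R.1.mulVec (siteW x)) ?_ x (Or.inr rfl))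
    simpa [hψR, Matrix.mulVec_smul] using hx
  -- supports
  have hsupp₀ : ∀ v, ψ₀ v ≠ 0 → ‖v‖ < Bφ / κ := fun v hv => by
    have := hsupp _ hv
    rw [norm_smul, Real.norm_eq_abs, abs_of_pos hκ0] at this
    rwa [lt_div_iff₀ hκ0, mul_comm]
  have hsuppR : ∀ v, ψR v ≠ 0 → ‖v‖ < 3 * Bφ / κ := fun v hv => by
    have h1 := hsupp _ hv
    rw [norm_smul, Real.norm_eq_abs, abs_of_pos hκ0] at h1
    have h2 : ‖v‖ ^ 2 ≤ 3 * ‖R.1.mulVec v‖ ^ 2 := norm_sq_le_three_mul_norm_mulVec_sq R v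
    have h3 : ‖v‖ < 3 * (Bφ / κ) := by
      have hb : ‖R.1.mulVec v‖ < Bφ / κ := by rwa [lt_div_iff₀ hκ0, mul_comm]
      nlinarith [norm_nonneg v, norm_nonneg (R.1.mulVec v), div_pos hBφ hκ0]
    rwa [mul_div_assoc]
  -- transfer bounds for both sums
  obtain ⟨hsumD, hD1, hD2⟩ := transfer_bounds hβ0.le hβc hξpos ψ₀ (fun v => hφ0 _) hψ₀m
    (fun v => hφb _) hsupp₀ hwin₀
  obtain ⟨hsumN, hN1, hN2⟩ := transfer_bounds hβ0.le hβc hξpos ψR (fun v => hφ0 _) hψRm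
    (fun v => hφb _) hsuppR hwinR
  -- identify the sums in the goal and the integrals
  have hDsum : (∑' x : Site 3, φ (L⁻¹ • fun i => ((x i : ℤ) : ℝ)) * criticalTwoPoint 3 x) =
      ∑' x : Site 3, ψ₀ ((xi β)⁻¹ • siteW x) * criticalTwoPoint 3 x := by
    refine tsum_congr fun x => ?_
    simp only [hψ₀, smul_smul, ← hLinv]; rfl
  have hNsum : (∑' x : Site 3, φ (L⁻¹ • R.1.mulVec fun i => ((x i : ℤ) : ℝ)) *
      criticalTwoPoint 3 x) = ∑' x : Site 3, ψR ((xi β)⁻¹ • siteW x) * criticalTwoPoint 3 x := by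
    refine tsum_congr fun x => ?_
    simp only [hψR, Matrix.mulVec_smul, smul_smul, ← hLinv]; rfl
  have hIeq : ∫ y, ψ₀ (WithLp.ofLp y) ∂(nu β) = ∫ y, ψ y ∂(nu β) := rfl
  have hIReq : ∫ y, ψR (WithLp.ofLp y) ∂(nu β) = ∫ y, ψ (T y) ∂(nu β) := by
    refine integral_congr_ae (ae_of_all _ fun y => ?_)
    simp only [hψR, hψ, hT y]
  rw [hIeq] at hD1 hD2
  rw [hIReq] at hN1 hN2
  rw [hDsum, hNsum]
  -- the final arithmetic
  have hIpos : 0 < ∫ y, ψ y ∂(nu β) := lt_of_lt_of_le hιm hIlow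
  have hIR : |(∫ y, ψ (T y) ∂(nu β)) - ∫ y, ψ y ∂(nu β)| ≤ ε * ∫ y, ψ y ∂(nu β) :=
    hAIβ.le.trans (mul_le_mul_of_nonneg_left hIlow hε0.le)
  have hN0 : 0 ≤ ∑' x : Site 3, ψR ((xi β)⁻¹ • siteW x) * criticalTwoPoint 3 x :=
    tsum_nonneg fun x => mul_nonneg (hφ0 _) (criticalTwoPoint_nonneg' x)
  have h := ratio_estimate hε0 hε2 hχ hIpos hN0 hD1 hD2 hN1 hN2 hIR
  rw [Real.dist_eq]
  linarith [abs_nonneg ((∑' x : Site 3, ψR ((xi β)⁻¹ • siteW x) * criticalTwoPoint 3 x) /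
    (∑' x : Site 3, ψ₀ ((xi β)⁻¹ • siteW x) * criticalTwoPoint 3 x) - 1)]

/-- **Item `DilutionTransfer` (stmt-CriticalPhenomena-6037) of route `HarmonicMomentsIsotropy`.**
Subcritical harmonic dilution, the `ξ₂`-window (CLW) and the existence of a scale-covariant
non-degenerate pointwise limit (EX) imply vague asymptotic isotropy of the critical two-point
function on `ℤ³`:
`∑ₓ φ(Rx/L)⟨σ₀σₓ⟩_{β_c} / ∑ₓ φ(x/L)⟨σ₀σₓ⟩_{β_c} → 1` (`L → ∞`) for every continuous compactly
supported `φ ≥ 0`, `φ ≢ 0`, and every `R ∈ O(3)`.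
Proof (the planner's sketch of the item, route file): with `ν_β = χ⁻¹∑ G_β δ_{x/ξ₂}`, CLW (ii) gives
uniform exponential moments, so along `β ↑ β_c` weak limits exist and moments converge; harmonic
dilution kills all `Y|y|^{2m}`-moments of a limit, the Fischer decomposition makes its marginal
moments radial, and moment determinacy makes it `O(3)`-invariant (`asymptotic_invariance`); EX
gives, through Riemann sums and a Karamata-type shell domination, that `ν_β` charges cubes away
from the origin (`nu_charge`); finally for `L → ∞` one chooses `β(L) ↑ β_c` with `ξ₂(β(L)) = κL`
(continuity of `ξ₂`, IVT) and compares both lattice sums with `χ ∫ φ_κ dν_β` inside the critical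
window CLW (i) (`transfer_bounds`, `dilutionTransfer_core`). -/
theorem dilutionTransfer_proof :
    Summit.CriticalPhenomena.Ising3DConformalLimit.Theses.HarmonicMomentsIsotropy.DilutionTransfer := by
  intro hHD hCLW hEX φ hφc hφs hφ0 hφpos R
  obtain ⟨hI, hII⟩ := hCLW
  obtain ⟨ρ, Δ, S, hρ, -, hlim, -, hnd, -, hsc⟩ := hEX
  obtain ⟨c₀, C, hc₀, β₀, hβ₀, hII'⟩ := hII
  exact dilutionTransfer_core hHD hI hc₀ hβ₀ hII' hρ hlim hnd hsc φ hφc hφs hφ0 hφpos R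

end Summit.CriticalPhenomena.Ising3DConformalLimit.Theorems.HarmonicMomentsIsotropy

end
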